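import Summits.Ventures.YMGap.RobustBall.StringTensionOnBallW
import Summits.Ventures.YMGap.RobustBall.AreaLawRowsSU3FreePair
import Summits.Ventures.YMGap.RobustBall.AreaLawRowsPairW
import HarnessLib

/-!
# Venture YMGap, track Y2 ROBUST-BALL — `SU(3)` STRING TENSION ON THE TIER-2 (diameter-weighted) BALL: the infinite-volume reading of the
# `SU(3)` tier-2 area-law rows, `d = 4`, weight `κ = log(6/5)`

HONEST FRAMING.  Venture file of the cell `pub-ymgap` (QuantumFields programme), seat engine-2 (g7).  Strong-coupling LATTICE statements only;
nothing about the continuum, a spectral mass gap, weak coupling, or Clay.  rb-p2's `suFundStringTension_ge_onBallW` (tree: every `N`, input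
`AreaLawOnBallW N 4 β κ ε₀ ε₁ mv` BY NAME) turns each tier-2 TORUS area-law row — members in the diameter-weighted ball `ClusterDomain κ ε₀ ε₁`
(INFINITE horizontal range, loads weighted `e^{κ·diam}`) with vertical window `mv` — into a statement about every INFINITE-VOLUME LIMIT STATE `μ`
of every eventually-member family: ONE pair `(C, c)`, `c > 0`, with the tree's `ℤ⁴` area law `HasAreaLawWith μ χ₃ C c` and `c ≤ suFundStringTension 3 μ`
WHENEVER the string tension of `μ` exists (existence NOT asserted).  The `SU(3)` instances:
* HYPOTHESIS-FREE (class K): the Bakry–Émery-pair tier-2 balls of `AreaLawRowsSU3FreePair` at `β_W = 1/8` (`ClusterDomain (log 6/5) 0.794 0.397`)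
  and `β_W = 1/4` (`ClusterDomain (log 6/5) 0.374 0.187`);
* CONDITIONAL on the cell's certified pairs (NOTHING asserted about H1 `OneLinkPoincareSUN 3 (3/5) (4/5)`, H2 `OneLinkVarianceBound 3 (11/30) (49/20)`,
  H2′ `OneLinkVarianceBound 3 (3/5) (17/5)`; classes «K × C(H1) × C-iv(H2)» / «K × C(H1) × C⁻(H2′)»): the tier-2 pair-door balls of `AreaLawRowsPairW`
  at `β_W = 1/2` on P11 (`ClusterDomain (log 6/5) 0.428 0.214`) and `β_W = 3/4` on P35 (`ClusterDomain (log 6/5) 0.088 0.044`).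
Every row holds for every vertical window `mv ≥ 1`; no range cut-off.
-/

noncomputable section

open MeasureTheory Filter Topology
open Literature.MathematicalPhysics.QuantumLattice
open Literature.MathematicalPhysics.QuantumFieldTheory hiding ZdEdge Site
open Literature.Barriers.QuantumFields (suFundStringTension)
open Summit.QuantumFields.BalabanUV.InfraRed.StrongCouplingPoincareDoorSUN (OneLinkPoincareSUN)
open Summit.QuantumFields.BalabanUV.InfraRed.StrongCouplingVarianceDoorSUN (OneLinkVarianceBound)
open Summit.Ventures.YMGap.RobustBall
  (AreaLawOnBallW ClusterDomain IsSlabLocal PerturbationFamily perturbedLimitPoints suFundStringTension_ge_onBallW)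
open Summit.Ventures.YMGap.RobustBallPair (su3_hsRowW4_1_2_w65 su3_hsRowW4_3_4_w65)

namespace Summit.Ventures.YMGap.RobustBallSU3

/-- **`SU(3)`, `d = 4`, `β_W = 1/8`, TIER-2 ball `ClusterDomain (log 6/5) 0.794 0.397`, HYPOTHESIS-FREE: string tension on the ball.**  One `c > 0`
such that every infinite-volume limit state `μ` of every eventually-member family satisfies `HasAreaLawWith μ χ₃ C c` and, whenever its string tension
exists, `c ≤ suFundStringTension 3 μ`.  Input: `su3_freePairRowW4_1_8_w65`. [folklore] -/
theorem su3_stringTension_onBallW_free_1_8_w65 {mv : ℕ} (hmv : 1 ≤ mv) :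
    ∃ C c : ℝ, 0 < c ∧ ∀ 𝓦 : PerturbationFamily 4 3,
      (∀ᶠ L : ℕ in atTop, 𝓦 L ∈ ClusterDomain (Real.log (6 / 5)) (2 * (397 / 1000)) (397 / 1000) ∧ IsSlabLocal mv (𝓦 L)) →
        ∀ μ ∈ perturbedLimitPoints ((1 / 8 : ℝ) / 3) 𝓦,
          HasAreaLawWith μ (fun g => normalisedCharacter 3 (fundamentalRep (Fin 3) g)) C c ∧
          ((∃ σ : ℝ, HasStringTension μ (fun g => normalisedCharacter 3 (fundamentalRep (Fin 3) g)) σ) →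
            c ≤ suFundStringTension 3 μ) :=
  suFundStringTension_ge_onBallW (su3_freePairRowW4_1_8_w65 hmv)

/-- **`SU(3)`, `d = 4`, `β_W = 1/4`, TIER-2 ball `ClusterDomain (log 6/5) 0.374 0.187`, HYPOTHESIS-FREE**: the same, from `su3_freePairRowW4_1_4_w65`.
[folklore] -/
theorem su3_stringTension_onBallW_free_1_4_w65 {mv : ℕ} (hmv : 1 ≤ mv) :
    ∃ C c : ℝ, 0 < c ∧ ∀ 𝓦 : PerturbationFamily 4 3,
      (∀ᶠ L : ℕ in atTop, 𝓦 L ∈ ClusterDomain (Real.log (6 / 5)) (2 * (187 / 1000)) (187 / 1000) ∧ IsSlabLocal mv (𝓦 L)) →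
        ∀ μ ∈ perturbedLimitPoints ((1 / 4 : ℝ) / 3) 𝓦,
          HasAreaLawWith μ (fun g => normalisedCharacter 3 (fundamentalRep (Fin 3) g)) C c ∧
          ((∃ σ : ℝ, HasStringTension μ (fun g => normalisedCharacter 3 (fundamentalRep (Fin 3) g)) σ) →
            c ≤ suFundStringTension 3 μ) :=
  suFundStringTension_ge_onBallW (su3_freePairRowW4_1_4_w65 hmv)

/-- **`SU(3)`, `d = 4`, `β_W = 1/2`, TIER-2 ball `ClusterDomain (log 6/5) 0.428 0.214`, GIVEN H1, H2** (tier-2 pair door on P11,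
`su3_hsRowW4_1_2_w65`): string tension on the ball, one `c > 0` for every infinite-volume limit state of every eventually-member family. [folklore] -/
theorem su3_stringTension_onBallW_1_2_w65_of_certificates (hP : OneLinkPoincareSUN 3 (3 / 5) (4 / 5))
    (hV : OneLinkVarianceBound 3 (11 / 30) (49 / 20)) {mv : ℕ} (hmv : 1 ≤ mv) :
    ∃ C c : ℝ, 0 < c ∧ ∀ 𝓦 : PerturbationFamily 4 3,
      (∀ᶠ L : ℕ in atTop, 𝓦 L ∈ ClusterDomain (Real.log (6 / 5)) (2 * (107 / 500)) (107 / 500) ∧ IsSlabLocal mv (𝓦 L)) →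
        ∀ μ ∈ perturbedLimitPoints ((1 / 2 : ℝ) / 3) 𝓦,
          HasAreaLawWith μ (fun g => normalisedCharacter 3 (fundamentalRep (Fin 3) g)) C c ∧
          ((∃ σ : ℝ, HasStringTension μ (fun g => normalisedCharacter 3 (fundamentalRep (Fin 3) g)) σ) →
            c ≤ suFundStringTension 3 μ) :=
  suFundStringTension_ge_onBallW (su3_hsRowW4_1_2_w65 hmv hP hV)

/-- **`SU(3)`, `d = 4`, `β_W = 3/4`, TIER-2 ball `ClusterDomain (log 6/5) 0.088 0.044`, GIVEN H1, H2′** (tier-2 pair door on P35,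
`su3_hsRowW4_3_4_w65`). [folklore] -/
theorem su3_stringTension_onBallW_3_4_w65_of_nineTenthsPair (hP : OneLinkPoincareSUN 3 (3 / 5) (4 / 5))
    (hV : OneLinkVarianceBound 3 (3 / 5) (17 / 5)) {mv : ℕ} (hmv : 1 ≤ mv) :
    ∃ C c : ℝ, 0 < c ∧ ∀ 𝓦 : PerturbationFamily 4 3,
      (∀ᶠ L : ℕ in atTop, 𝓦 L ∈ ClusterDomain (Real.log (6 / 5)) (2 * (11 / 250)) (11 / 250) ∧ IsSlabLocal mv (𝓦 L)) →
        ∀ μ ∈ perturbedLimitPoints ((3 / 4 : ℝ) / 3) 𝓦,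
          HasAreaLawWith μ (fun g => normalisedCharacter 3 (fundamentalRep (Fin 3) g)) C c ∧
          ((∃ σ : ℝ, HasStringTension μ (fun g => normalisedCharacter 3 (fundamentalRep (Fin 3) g)) σ) →
            c ≤ suFundStringTension 3 μ) :=
  suFundStringTension_ge_onBallW (su3_hsRowW4_3_4_w65 hmv hP hV)

end Summit.Ventures.YMGap.RobustBallSU3

end
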